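import Summits.KontsevichZagierPeriods.KontsevichZagierPeriods.Theorems.LinRedNormalFormArrangementNormalFormStubRebaseOneTools
import Summits.KontsevichZagierPeriods.KontsevichZagierPeriods.Theorems.LinRedNormalFormArrangementNormalFormStubRebaseOneCov

/-!
# Stub `stub_rebaseOne` (crux `ArrangementNormalForm`, line `janus-bands`) — part `Janus`

The JANUS SPLIT of `stub_rebaseOne` (skeleton v4 of crux `ArrangementNormalForm`, line
`janus-bands`). Dissection of a band representation into sub-bands (rule 1a, null walls), and the
Janus extension `[T] = [D] + [W]` of a lettered band `D = {u < t < v}` by a WEDGE `W` up (or down) to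
a level `c + K` parallel to the letter `c`: `T = {u < t < c + K}`, `W = {v < t < c + K}` (resp.
`T = {c + K < t < v}`, `W = {c + K < t < u}`). The heart is the ABSOLUTE CONVERGENCE of the wedge
(`integrableOn_wedge`), obtained softly: the wedge lies in the image of `D` under a fibrewise affine
map `ψ(y, t) = (y, P(y) + λ (t − u(y)))` as soon as its fibres are at most `λ` times as long as
those of `D` (this holds with the apex level at a pinch, and with any level on a thick band), the
base factor `g(y)` is integrable on `D` (domination by `|t − c| · |integrand|`), hence on `ψ(D)`
(rule-2 transport of integrability), and `1/(t − c) ≤ 1/m` on the wedge.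

References: M. Kontsevich, D. Zagier, *Periods* (2001), §1.2, rules (1a), (2).
-/

noncomputable section

open Set MeasureTheory
open Literature.NumberTheory.Transcendental
open Literature.ModelTheory.ExponentialFields

namespace Summit.KontsevichZagierPeriods.ArrangementNormalForm.JanusBands

namespace RebaseOne

/-! ### Dissection into sub-bands -/

/-- **Dissection** (rule 1a). If finitely many pairwise disjoint sub-bands cover the domain of a
band representation up to a null set, and every band representation on each of them is good,
then the representation is good. -/
theorem good_of_pieces {r : KZ.IntegralRep 2} {m : ℕ} {M : Fin m → Aff} {U V : Aff} {T : IData}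
    {a : Option Aff} (h : IsBandRep r M U V T a) {ι : Type*} [Fintype ι] {m' : ι → ℕ}
    (M' : ∀ i, Fin (m' i) → Aff) (U' V' : ι → Aff)
    (hsub : ∀ i, band (baseSet (M' i)) (ev (U' i)) (ev (V' i)) ⊆ r.domain)
    (hdisj : Pairwise fun i j => Disjoint (band (baseSet (M' i)) (ev (U' i)) (ev (V' i)))
      (band (baseSet (M' j)) (ev (U' j)) (ev (V' j))))
    {N : Set (Fin 2 → ℝ)} (hN : volume N = 0)
    (hcov : ∀ z ∈ r.domain, z ∉ N → ∃ i, z ∈ band (baseSet (M' i)) (ev (U' i)) (ev (V' i)))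
    (hgood : ∀ i, ∀ r' : KZ.IntegralRep 2, IsBandRep r' (M' i) (U' i) (V' i) T a → Good (KZ.of r')) :
    Good (KZ.of r) := by
  classical
  set R : ι → KZ.IntegralRep 2 := fun i =>
    r.restrict _ (isSemialgebraic_band (M' i) (U' i) (V' i)) (hsub i) with hR
  have hrel : KZ.of r - ∑ i, KZ.of (R i) ∈ KZ.relations := by
    refine KZ.of_sub_sum_of_mem_relations Finset.univ r R (fun i _ => ?_) (fun i _ _ _ => rfl) ?_ ?_
    · rw [show (R i).domain = band (baseSet (M' i)) (ev (U' i)) (ev (V' i)) from rfl,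
        Set.sdiff_eq_empty.2 (hsub i), measure_empty]
    · refine measure_mono_null (fun z hz => ?_) hN
      by_contra hzN
      obtain ⟨i, hi⟩ := hcov z hz.1 hzN
      exact hz.2 (mem_iUnion₂.2 ⟨i, Finset.mem_univ i, hi⟩)
    · intro i _ j _ hij
      rw [show (R i).domain = band (baseSet (M' i)) (ev (U' i)) (ev (V' i)) from rfl,
        show (R j).domain = band (baseSet (M' j)) (ev (U' j)) (ev (V' j)) from rfl,
        (hdisj hij).inter_eq, measure_empty]
  exact good_of_sub_mem hrel (good_sum _ _ fun i _ => hgood i (R i) (h.restrict _ _ _ (hsub i)))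

/-! ### Bounds -/

/-- The base of a band representation with non-empty fibres is bounded. -/
theorem abs_base_le {r : KZ.IntegralRep 2} {m : ℕ} {M : Fin m → Aff} {U V : Aff} {T : IData}
    {a : Option Aff} (h : IsBandRep r M U V T a) (hUV : ∀ y ∈ baseSet M, ev U y < ev V y) :
    ∃ Rb : ℝ, 0 ≤ Rb ∧ ∀ y ∈ baseSet M, |y| ≤ Rb := by
  obtain ⟨Rb, hRb0, hRb⟩ := exists_abs_le h.bdd
  refine ⟨Rb, hRb0, fun y hy => ?_⟩
  have hyD : (![y, (ev U y + ev V y) / 2] : Fin 2 → ℝ) ∈ r.domain := by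
    rw [h.dom]
    have := hUV y hy
    refine ⟨hy, ?_, ?_⟩ <;> simp <;> linarith
  exact (hRb _ hyD).1

/-- A band over a bounded base with affine bounds is bounded. -/
theorem isBounded_band_of {m : ℕ} (M : Fin m → Aff) (U V : Aff) (Rb : ℝ)
    (hy : ∀ y ∈ baseSet M, |y| ≤ Rb) : Bornology.IsBounded (band (baseSet M) (ev U) (ev V)) := by
  refine isBounded_of_abs_le (Rb + ((|(U.1 : ℝ)| * Rb + |(U.2 : ℝ)|) + (|(V.1 : ℝ)| * Rb + |(V.2 : ℝ)|)))
    fun z hz => ?_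
  obtain ⟨h0, h1, h2⟩ := hz
  have hyb := hy _ h0
  have hU := abs_ev_le U (z 0)
  have hV := abs_ev_le V (z 0)
  have hU' : |ev U (z 0)| ≤ |(U.1 : ℝ)| * Rb + |(U.2 : ℝ)| := hU.trans (by gcongr)
  have hV' : |ev V (z 0)| ≤ |(V.1 : ℝ)| * Rb + |(V.2 : ℝ)| := hV.trans (by gcongr)
  have hRb0 : 0 ≤ Rb := (abs_nonneg _).trans hyb
  have hA : 0 ≤ |(U.1 : ℝ)| * Rb + |(U.2 : ℝ)| := by positivity
  have hB : 0 ≤ |(V.1 : ℝ)| * Rb + |(V.2 : ℝ)| := by positivity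
  refine ⟨hyb.trans (le_add_of_nonneg_right (add_nonneg hA hB)), ?_⟩
  rw [abs_le] at hU' hV' ⊢
  constructor <;> linarith

/-! ### The wedge -/

/-- **Absolute convergence on a wedge.** Let `D = {u < t < v}` carry the lettered integrand
`g(y)/(t − c(y))` absolutely convergently. If `W = {P < t < Q}` (over the same base) stays at
distance `≥ m > 0` above the letter and its fibres are at most `λ` times as long as those of `D`,
then the integrand converges absolutely on `W`. -/
theorem integrableOn_wedge {r : KZ.IntegralRep 2} {m : ℕ} {M : Fin m → Aff} {U V : Aff} {T : IData}
    {c : Aff} (h : IsBandRep r M U V T (some c)) (P Q : Aff) (lam mlo : ℝ) (hlam : 0 < lam)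
    (hPQ : ∀ y ∈ baseSet M, 0 < mlo ∧ mlo ≤ ev P y - ev c y ∧
      ev Q y - ev P y ≤ lam * (ev V y - ev U y)) :
    IntegrableOn (integ T (some c)) (band (baseSet M) (ev P) (ev Q)) := by
  have hDm : MeasurableSet r.domain := by rw [h.dom]; exact measurableSet_band M U V
  have hWm : MeasurableSet (band (baseSet M) (ev P) (ev Q)) := measurableSet_band M P Q
  obtain ⟨Rb, hRb0, hRb⟩ := exists_abs_le h.bdd
  set g : (Fin 2 → ℝ) → ℝ := fun z => gfun T (z 0) with hg
  have hgm : Measurable g := by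
    simp only [hg, gfun]; fun_prop
  set Kc : ℝ := Rb + (|(c.1 : ℝ)| * Rb + |(c.2 : ℝ)|) with hKc
  -- (1) `g` is integrable on `D`
  have hfD : IntegrableOn (integ T (some c)) r.domain := r.integrableOn.congr_fun h.int hDm
  have hgD : IntegrableOn g r.domain := by
    refine Integrable.mono' (hfD.norm.const_mul Kc) hgm.aestronglyMeasurable ?_
    filter_upwards [ae_restrict_mem hDm,
      ae_restrict_of_ae (measure_eq_zero_iff_ae_notMem.1 (volume_graph_ev c))] with z hz hzN
    have hd : z 1 - ev c (z 0) ≠ 0 := sub_ne_zero.2 hzN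
    have hdle : |z 1 - ev c (z 0)| ≤ Kc := by
      obtain ⟨h0, h1⟩ := hRb z hz
      calc |z 1 - ev c (z 0)| ≤ |z 1| + |ev c (z 0)| := abs_sub _ _
        _ ≤ Rb + (|(c.1 : ℝ)| * Rb + |(c.2 : ℝ)|) :=
            add_le_add h1 ((abs_ev_le c _).trans (by gcongr))
    rw [Real.norm_eq_abs, Real.norm_eq_abs]
    have hfz : integ T (some c) z * (z 1 - ev c (z 0)) = g z := by
      simp only [integ, Option.elim_some, hg]; field_simp
    rw [← hfz, abs_mul, mul_comm]
    exact mul_le_mul_of_nonneg_right hdle (abs_nonneg _)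
  -- (2) transport through `ψ (y, t) = (y, P(y) + λ (t - u(y)))`
  set ψ := affMap 1 0 lam ((P.1 : ℝ) - lam * U.1) ((P.2 : ℝ) - lam * U.2) with hψ
  have hψD : IntegrableOn g (ψ '' r.domain) := by
    rw [integrableOn_image_affMap one_ne_zero hlam.ne' _ _ _ hDm g]
    exact hgD.congr_fun (fun z _ => by simp [hg]) hDm
  -- (3) the wedge lies in `ψ '' D`
  have hWsub : band (baseSet M) (ev P) (ev Q) ⊆ ψ '' r.domain := by
    rintro z ⟨hy, h1, h2⟩
    obtain ⟨-, -, hlen⟩ := hPQ _ hy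
    refine ⟨![z 0, ev U (z 0) + (z 1 - ev P (z 0)) / lam], ?_, ?_⟩
    · rw [h.dom]
      refine ⟨hy, ?_, ?_⟩
      · simp only [Matrix.cons_val_zero, Matrix.cons_val_one, Matrix.cons_val_fin_one,
          lt_add_iff_pos_right]
        exact div_pos (by linarith) hlam
      · simp only [Matrix.cons_val_zero, Matrix.cons_val_one, Matrix.cons_val_fin_one]
        have : (z 1 - ev P (z 0)) / lam < ev V (z 0) - ev U (z 0) := by
          rw [div_lt_iff₀ hlam]; linarith
        linarith
    · ext i
      fin_cases i
      · simp [hψ]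
      · simp [hψ, ev]; field_simp; ring
  have hgW : IntegrableOn g (band (baseSet M) (ev P) (ev Q)) := hψD.mono_set hWsub
  -- (4) `1/(t - c) ≤ 1/m` on the wedge
  refine Integrable.mono' (hgW.norm.const_mul (1 / mlo))
    (measurable_integ T (some c)).aestronglyMeasurable ?_
  filter_upwards [ae_restrict_mem hWm] with z hz
  obtain ⟨hm0, hmP, -⟩ := hPQ _ hz.1
  have hd : mlo ≤ z 1 - ev c (z 0) := by linarith [hz.2.1]
  have hdpos : 0 < z 1 - ev c (z 0) := lt_of_lt_of_le hm0 hd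
  rw [Real.norm_eq_abs, Real.norm_eq_abs]
  simp only [integ, Option.elim_some, abs_mul]
  rw [abs_of_pos (one_div_pos.2 hdpos), mul_comm]
  exact mul_le_mul_of_nonneg_right (one_div_le_one_div_of_le hm0 hd) (abs_nonneg _)

/-! ### The Janus extension -/

/-- **Janus extension, core.** If `T ⊇ D, W` with `T ∖ (D ∪ W)` null, `D ∩ W = ∅`, `T` bounded and
the lettered integrand absolutely convergent on the wedge `W`, then `T` and `W` carry band
representations with `[T] − ([D] + [W]) ∈ KZ.relations` (rule 1a). -/
theorem janus_core {r : KZ.IntegralRep 2} {m : ℕ} {M : Fin m → Aff} {U V : Aff} {T : IData}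
    {c : Aff} (h : IsBandRep r M U V T (some c)) (U₀ V₀ P Q : Aff)
    (hW : IntegrableOn (integ T (some c)) (band (baseSet M) (ev P) (ev Q)))
    {N : Set (Fin 2 → ℝ)} (hN : volume N = 0)
    (hTsub : band (baseSet M) (ev U₀) (ev V₀) ⊆ r.domain ∪ band (baseSet M) (ev P) (ev Q) ∪ N)
    (hDT : r.domain ⊆ band (baseSet M) (ev U₀) (ev V₀))
    (hWT : band (baseSet M) (ev P) (ev Q) ⊆ band (baseSet M) (ev U₀) (ev V₀))
    (hDW : Disjoint r.domain (band (baseSet M) (ev P) (ev Q)))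
    (hbd : Bornology.IsBounded (band (baseSet M) (ev U₀) (ev V₀))) :
    ∃ rT rW : KZ.IntegralRep 2, IsBandRep rT M U₀ V₀ T (some c) ∧ IsBandRep rW M P Q T (some c) ∧
      KZ.of rT - (KZ.of r + KZ.of rW) ∈ KZ.relations := by
  have hDm : MeasurableSet r.domain := by rw [h.dom]; exact measurableSet_band M U V
  have hfD : IntegrableOn (integ T (some c)) r.domain := r.integrableOn.congr_fun h.int hDm
  have hfT : IntegrableOn (integ T (some c)) (band (baseSet M) (ev U₀) (ev V₀)) :=
    ((hfD.union hW).union (integrableOn_of_null hN)).mono_set hTsub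
  set rW : KZ.IntegralRep 2 := ⟨_, integ T (some c), isSemialgebraic_band M P Q,
    isSemialgebraicFunOn_integ (isSemialgebraic_band M P Q) _ _, hW⟩ with hrW
  set rT : KZ.IntegralRep 2 := ⟨_, integ T (some c), isSemialgebraic_band M U₀ V₀,
    isSemialgebraicFunOn_integ (isSemialgebraic_band M U₀ V₀) _ _, hfT⟩ with hrT
  refine ⟨rT, rW, ⟨rfl, fun _ _ => rfl, hbd, h.adm⟩, ⟨rfl, fun _ _ => rfl, hbd.subset hWT, h.adm⟩, ?_⟩
  set R : Fin 2 → KZ.IntegralRep 2 := ![r, rW] with hR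
  have hR0 : R 0 = r := rfl
  have hR1 : R 1 = rW := rfl
  have hrel : KZ.of rT - ∑ i, KZ.of (R i) ∈ KZ.relations := by
    refine KZ.of_sub_sum_of_mem_relations Finset.univ rT R ?_ ?_ ?_ ?_
    · refine Fin.forall_fin_two.2 ⟨fun _ => ?_, fun _ => ?_⟩
      · rw [hR0, Set.sdiff_eq_empty.2 hDT, measure_empty]
      · rw [hR1, Set.sdiff_eq_empty.2 hWT, measure_empty]
    · refine Fin.forall_fin_two.2 ⟨fun _ z hz => ?_, fun _ _ _ => rfl⟩
      rw [hR0] at hz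
      exact h.int hz.1
    · refine measure_mono_null (fun z hz => ?_) hN
      have hz' : z ∉ r.domain ∪ band (baseSet M) (ev P) (ev Q) := fun hz' => hz.2 <| by
        rcases hz' with hz' | hz'
        · exact mem_iUnion₂.2 ⟨0, Finset.mem_univ _, hz'⟩
        · exact mem_iUnion₂.2 ⟨1, Finset.mem_univ _, hz'⟩
      rcases hTsub hz.1 with hz1 | hz1
      · exact absurd hz1 hz'
      · exact hz1
    · intro i _ j _ hij
      have key : ∀ i j : Fin 2, i ≠ j → (R i).domain ∩ (R j).domain = ∅ := by
        refine Fin.forall_fin_two.2 ⟨Fin.forall_fin_two.2 ⟨fun h => absurd rfl h, fun _ => ?_⟩,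
          Fin.forall_fin_two.2 ⟨fun _ => ?_, fun h => absurd rfl h⟩⟩
        · rw [hR0, hR1]; exact hDW.inter_eq
        · rw [hR0, hR1, inter_comm]; exact hDW.inter_eq
      rw [key i j hij, measure_empty]
  simpa [Fin.sum_univ_two, hR0, hR1] using hrel

/-- **Janus extension upwards.** A lettered band `D = {u < t < v}` above its letter `c`, under a
level `c + K` with `v ≤ c + K`, `v − c ≥ m > 0` and `(c + K − v) ≤ λ (v − u)` on the base, extends to
`T = {u < t < c + K}` by the wedge `W = {v < t < c + K}`: both are band representations and
`[T] − ([D] + [W]) ∈ KZ.relations`. -/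
theorem janus_up {r : KZ.IntegralRep 2} {m : ℕ} {M : Fin m → Aff} {U V : Aff} {T : IData}
    {c : Aff} (h : IsBandRep r M U V T (some c)) (K : ℚ) (lam mlo : ℝ) (hlam : 0 < lam)
    (hI : ∀ y ∈ baseSet M, ev U y < ev V y ∧ ev V y ≤ ev c y + K ∧ 0 < mlo ∧
      mlo ≤ ev V y - ev c y ∧ ev c y + K - ev V y ≤ lam * (ev V y - ev U y)) :
    ∃ rT rW : KZ.IntegralRep 2, IsBandRep rT M U (c + (0, K)) T (some c) ∧
      IsBandRep rW M V (c + (0, K)) T (some c) ∧ KZ.of rT - (KZ.of r + KZ.of rW) ∈ KZ.relations := by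
  have hcK : ∀ y, ev (c + (0, K)) y = ev c y + K := fun y => by simp [ev_mk]
  have hW : IntegrableOn (integ T (some c)) (band (baseSet M) (ev V) (ev (c + (0, K)))) :=
    integrableOn_wedge h V (c + (0, K)) lam mlo hlam fun y hy => by
      obtain ⟨-, -, hm0, hmV, hlen⟩ := hI y hy
      exact ⟨hm0, hmV, by rw [hcK]; exact hlen⟩
  obtain ⟨Rb, -, hRb⟩ := abs_base_le h fun y hy => (hI y hy).1
  refine janus_core h U (c + (0, K)) V (c + (0, K)) hW (volume_graph_ev V) ?_ ?_ ?_ ?_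
    (isBounded_band_of M U _ Rb hRb)
  · rintro z ⟨hy, h1, h2⟩
    rcases lt_trichotomy (z 1) (ev V (z 0)) with ht | ht | ht
    · exact Or.inl (Or.inl (by rw [h.dom]; exact ⟨hy, h1, ht⟩))
    · exact Or.inr ht
    · exact Or.inl (Or.inr ⟨hy, ht, h2⟩)
  · rw [h.dom]
    rintro z ⟨hy, h1, h2⟩
    exact ⟨hy, h1, by rw [hcK]; linarith [(hI _ hy).2.1]⟩
  · rintro z ⟨hy, h1, h2⟩
    exact ⟨hy, by linarith [(hI _ hy).1], h2⟩
  · rw [h.dom]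
    exact Set.disjoint_left.2 fun z hz hz' => by linarith [hz.2.2, hz'.2.1]

/-- **Janus extension downwards.** A lettered band `D = {u < t < v}` above a level `c + K`
(`K > 0`, `c + K ≤ u`) with `(u − c − K) ≤ λ (v − u)` on the base extends to `T = {c + K < t < v}`
by the wedge `W = {c + K < t < u}`. -/
theorem janus_down {r : KZ.IntegralRep 2} {m : ℕ} {M : Fin m → Aff} {U V : Aff} {T : IData}
    {c : Aff} (h : IsBandRep r M U V T (some c)) (K : ℚ) (lam : ℝ) (hlam : 0 < lam) (hK : 0 < K)
    (hI : ∀ y ∈ baseSet M, ev U y < ev V y ∧ ev c y + K ≤ ev U y ∧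
      ev U y - (ev c y + K) ≤ lam * (ev V y - ev U y)) :
    ∃ rT rW : KZ.IntegralRep 2, IsBandRep rT M (c + (0, K)) V T (some c) ∧
      IsBandRep rW M (c + (0, K)) U T (some c) ∧ KZ.of rT - (KZ.of r + KZ.of rW) ∈ KZ.relations := by
  have hcK : ∀ y, ev (c + (0, K)) y = ev c y + K := fun y => by simp [ev_mk]
  have hW : IntegrableOn (integ T (some c)) (band (baseSet M) (ev (c + (0, K))) (ev U)) :=
    integrableOn_wedge h (c + (0, K)) U lam K hlam fun y hy => by
      obtain ⟨-, -, hlen⟩ := hI y hy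
      exact ⟨by exact_mod_cast hK, by rw [hcK]; linarith, by rw [hcK]; exact hlen⟩
  obtain ⟨Rb, -, hRb⟩ := abs_base_le h fun y hy => (hI y hy).1
  refine janus_core h (c + (0, K)) V (c + (0, K)) U hW (volume_graph_ev U) ?_ ?_ ?_ ?_
    (isBounded_band_of M _ V Rb hRb)
  · rintro z ⟨hy, h1, h2⟩
    rcases lt_trichotomy (z 1) (ev U (z 0)) with ht | ht | ht
    · exact Or.inl (Or.inr ⟨hy, h1, ht⟩)
    · exact Or.inr ht
    · exact Or.inl (Or.inl (by rw [h.dom]; exact ⟨hy, ht, h2⟩))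
  · rw [h.dom]
    rintro z ⟨hy, h1, h2⟩
    exact ⟨hy, by rw [hcK]; linarith [(hI _ hy).2.1], h2⟩
  · rintro z ⟨hy, h1, h2⟩
    exact ⟨hy, h1, by linarith [(hI _ hy).1]⟩
  · rw [h.dom]
    exact Set.disjoint_left.2 fun z hz hz' => by linarith [hz.2.1, hz'.2.2]

end RebaseOne

/-- Registered support goal of this file: bands over bounded bases are bounded. -/
theorem rebaseOne_isBounded_band (m : ℕ) (M : Fin m → ℚ × ℚ) (U V : ℚ × ℚ) (Rb : ℝ) (hy : ∀ y ∈ RebaseOne.baseSet M, |y| ≤ Rb) : Bornology.IsBounded (RebaseOne.band (RebaseOne.baseSet M) (RebaseOne.ev U) (RebaseOne.ev V)) :=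
  RebaseOne.isBounded_band_of M U V Rb hy

end Summit.KontsevichZagierPeriods.ArrangementNormalForm.JanusBands
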